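/-
Copyright: the b2b-balaban T⁴-continuum CRUX team, row NE7b OWNER lineage `t4-ne7b-p1` (gen 108). Project licence.
-/
import Summits.QuantumFields.BalabanUV.T4Continuum.Spine.NE7b.ConvexWindowVirialSocket
import Summits.QuantumFields.BalabanUV.T4Continuum.Spine.NE7b.ConvexWindowMinimiserTilted

/-!
# THE WINDOWED CONVEXITY ROAD WITH THE CENTRE'S GRADIENT DISPLAYED, NOT ASKED TO VANISH: `∫_K e^{−V} ≤
# exp((Σ_k q_k)∕λ + q_max·(‖∇V 0‖∕λ + √(n∕λ))²)·∫_K e^{−(V+g)}` on a BOUNDED convex window with `0 ∈ K`, and its primitive-constants socket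
# `LocCondStability` BY NAME with `b = B∕(2σ−h) + q_max·(G₀∕(2σ−h) + √(n∕(2σ−h)))²`, `G₀ ≥ ‖∇P 0‖` (row NE7b, node U5c; residual (R2′) family (2);
# the refuter's κ-ne7bref-g72-1 (ii) ∕ N-ne7bref-g73-1 «`G₀` by value» AS THEOREMS, over leaf-01's `hcrit`-free letters)

Cell `pub-balaban`, sub-cell `t4`, spine estimate NE7b (`T4WeightBudget.RelWeightBound`; the cell's OWN estimate — NOT PRINTED in
[Bałaban 1983–89], NOT PROVED).  Crux-route work under `Spine/NE7b/` by the row's OWNER; NOTHING of Bałaban's is named or asserted;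
no `T4Continuum/Support` leaf typed; no `def`; zero `sorry`.

WHY.  The virial-centred END `…ConvexWindowTiltCentred.exp_moment_le_of_uniformlyConvex_on_boundedConvexWindow_orthonormal` and its
socket `…ConvexWindowVirialSocket` carry ONE letter beyond convexity on the window: the variational letter `0 ≤ ⟪∇V 0, y⟫` on `K`
(`DP(0) = 0` for `V = ⟪x,Ax⟫ + P`).  On the R-step fibre print KEEPS the linear term of its expansion and bounds it (refuter F461 ∕
κ-ne7bref-g73-1: [B16] (1.5)–(1.6) once the corridor letter pays), so the expansion point need NOT be critical.  leaf-01's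
`…ConvexWindowMinimiser` ∕ `…ConvexWindowMinimiserTilted` (refuter σ-ne7bref-g74-1 typed, and sharper: NO variational letter, NO
compactness) give `‖∫ y dν_{V,K}‖ ≤ ‖∇V 0‖∕λ + √(n∕λ)` from the two first-order letters at `(0, y)`, `(y, 0)` and the windowed virial
inequality.  With Bessel for orthonormal directions, `Σ_k q_k m_k² ≤ q_max(‖∇V 0‖∕λ + √(n∕λ))²`: the centre letter is GONE, replaced by the
displayed number `G₀ ≥ ‖∇V 0‖` — by value `≤ 1∕ρ = 10^{−56.7}` on the R-step once the corridor letter pays (refuter F464), NIL against the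
budget; §1 turns print's «absolute bound on the linear term over the window» into that `G₀`.

WHAT IS PROVED ([folklore]; leaf-01's `…ConvexWindowMinimiserTilted.norm_windowTiltedMean_le_of_gradient` BY NAME):
* §1 **`norm_le_div_of_inner_le_on_window`**: `B̄(0,ρ) ⊆ K`, `⟪w, y⟫ ≤ c` on `K` ⟹ `‖w‖ ≤ c∕ρ` — with `w = ∇V 0`, print's bound `c` on the
  linear term over a window containing the ball of radius `ρ` IS the letter `G₀ = c∕ρ`.
* §2 **`sum_mul_sq_windowTiltedMean_le_of_orthonormal_sharp`**: `K` convex bounded measurable of positive volume, `0 ∈ K`, `V ∈ C¹`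
  `λ`-convex ON `K`, `u` orthonormal, `q_k ≤ q_max`, `q_max ≥ 0` ⟹ `Σ_k q_k(∫⟪u_k,y⟫dν_{V,K})² ≤ q_max·(‖∇V 0‖∕λ + √(n∕λ))²`.
* §3 **`exp_moment_le_of_uniformlyConvex_on_boundedConvexWindow_orthonormal_of_gradient`**: THE END WITHOUT A CENTRE LETTER —
  `∫_K e^{−V} ≤ exp((Σ_k q_k)∕λ + q_max·(‖∇V 0‖∕λ + √(n∕λ))²) · ∫_K e^{−(V + Σ_k q_k⟪u_k,·⟫²)}`.
* §4 the primitive-constants twin **`exp_moment_le_of_quadratic_add_hessianSmall_on_convexWindow_orthonormal_of_gradient`** (`V = ⟪x,Ax⟫ + P`,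
  `A` symmetric `σ`-coercive, `P ∈ C²` Hessian-small `≥ −h` ON `K`, `‖∇P 0‖ ≤ G₀`, `h < 2σ`), `recentredWindowCarrier_le` (`Σ_k q_k ≤ B`) and
  the junction BY NAME **`locCondStability_of_recentredWindowCarrier_on_support`**: per `(j, g, y)` window, operator, remainder, weights,
  orthonormal directions; the numbers `σ, h, q_max, B, G₀` y-UNIFORM per `(j, g)` and the fibre dimension `n j g` ⟹
  `LocCondStability T S K μ ρ₀ M b`, `b j g = B∕(2σ−h) + q_max·(G₀∕(2σ−h) + √(n∕(2σ−h)))²` — the family-(2) socket WITHOUT a centre letter.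

NOT HERE (honest): the corridor letter that makes `G₀` small on the R-step (a HYPOTHESIS PLACEMENT of the R-step statement, refuter
κ-ne7bref-g73-1); the numbers by value ((A1c)∕(A3) readings); anything of Bałaban's.  NE7b NOT PRINTED ∕ NOT PROVED; spine PROVED 0∕9;
rung (B)+1 on a FINITE torus — NOT infinite volume, NOT the mass gap, NOT Clay.
HONEST DEPENDENCY: continuum YM on T⁴ ⇐ BetaPertH ∧ nine spine estimates (0/9 proved); BetaPertH ⇐ (D1) ∧ (D4) ∧ CAP+tail.
-/

set_option autoImplicit false

noncomputable section

open MeasureTheory Real Finset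
open scoped RealInnerProductSpace
open Summit.QuantumFields.BalabanUV.T4Continuum.B16HistoryIndexedRepr Summit.QuantumFields.BalabanUV.T4Continuum.B16HistoryReprChain
open Summit.QuantumFields.BalabanUV.T4Continuum.NE7b.PrefixExtraction Summit.QuantumFields.BalabanUV.T4Continuum.NE7b.LocalConditionalStability
open Summit.QuantumFields.BalabanUV.T4Continuum.NE7b.CarrierOnSupport
open Summit.QuantumFields.BalabanUV.T4Continuum.NE7b.ConvexTiltSuppliers
open Summit.QuantumFields.BalabanUV.T4Continuum.NE7b.ConvexWindowTiltMoment
open Summit.QuantumFields.BalabanUV.T4Continuum.NE7b.ConvexWindowVirial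
open Summit.QuantumFields.BalabanUV.T4Continuum.NE7b.ConvexWindowSuppliers
open Summit.QuantumFields.BalabanUV.T4Continuum.NE7b.ConvexWindowTiltCentred
open Summit.QuantumFields.BalabanUV.T4Continuum.NE7b.ConvexWindowVirialSocket
open Summit.QuantumFields.BalabanUV.T4Continuum.NE7b.ConvexWindowMinimiserTilted

namespace Summit.QuantumFields.BalabanUV.T4Continuum.NE7b.ConvexWindowTiltRecentred

variable {n : ℕ}

/-! ## §1 The gradient at the nominal centre is paid by a bound on the linear term over an inscribed ball -/

/-- **THE GRADIENT AT THE NOMINAL CENTRE IS PAID BY A BOUND ON THE LINEAR TERM OVER AN INSCRIBED BALL**: if `B̄(0, ρ) ⊆ K` with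
`ρ > 0` and the linear functional `y ↦ ⟪w, y⟫` is at most `c` on `K`, then `‖w‖ ≤ c∕ρ` (test at `y = (ρ∕‖w‖)•w`).  With `w = ∇V 0`
this turns print's «absolute bound on the linear term over the window» into the displayed `G₀ = c∕ρ`. [folklore] -/
theorem norm_le_div_of_inner_le_on_window {K : Set (EuclideanSpace ℝ (Fin n))} {w : EuclideanSpace ℝ (Fin n)} {ρ c : ℝ}
    (hρ : 0 < ρ) (hKB : Metric.closedBall (0 : EuclideanSpace ℝ (Fin n)) ρ ⊆ K) (h : ∀ y ∈ K, ⟪w, y⟫ ≤ c) :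
    ‖w‖ ≤ c / ρ := by
  have hc : 0 ≤ c := by simpa using h 0 (hKB (Metric.mem_closedBall_self hρ.le))
  by_cases hw : w = 0
  · rw [hw, norm_zero]; exact div_nonneg hc hρ.le
  have hwpos : 0 < ‖w‖ := norm_pos_iff.2 hw
  have hy : (ρ / ‖w‖) • w ∈ K := hKB (by
    rw [Metric.mem_closedBall, dist_zero_right, norm_smul, Real.norm_of_nonneg (div_nonneg hρ.le hwpos.le),
      div_mul_cancel₀ ρ hwpos.ne'])
  have h1 := h _ hy
  rw [real_inner_smul_right, real_inner_self_eq_norm_sq] at h1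
  rw [le_div_iff₀ hρ]
  have e : ρ / ‖w‖ * ‖w‖ ^ 2 = ‖w‖ * ρ := by field_simp
  linarith [e ▸ h1]

/-! ## §2 Bessel on the windowed tilted means, gradient form (sharp exponents) -/

/-- **BESSEL ON THE WINDOWED TILTED MEANS WITH THE CENTRE'S GRADIENT DISPLAYED**: `K` convex, bounded, measurable, of positive volume,
`0 ∈ K`; `V ∈ C¹`, `λ`-uniformly convex ON `K`; `u` ORTHONORMAL, `q_k ≤ q_max`, `q_max ≥ 0`.  Then
`Σ_k q_k(∫⟪u_k,y⟫ dν_{V,K})² ≤ q_max·(‖∇V 0‖∕λ + √(n∕λ))²` — leaf-01's `norm_windowTiltedMean_le_of_gradient` and Bessel; NO variational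
letter, NO compactness. [folklore] -/
theorem sum_mul_sq_windowTiltedMean_le_of_orthonormal_sharp {V : EuclideanSpace ℝ (Fin n) → ℝ} {lam qm : ℝ} {r : ℕ}
    {K : Set (EuclideanSpace ℝ (Fin n))} (hlam : 0 < lam) (hK : Convex ℝ K) (hKm : MeasurableSet K)
    (hKb : Bornology.IsBounded K) (hK0 : volume K ≠ 0) (h0 : (0 : EuclideanSpace ℝ (Fin n)) ∈ K) (hV1 : ContDiff ℝ 1 V)
    (hV : ∀ x ∈ K, ∀ y ∈ K, V x + ⟪gradient V x, y - x⟫ + lam / 2 * ‖y - x‖ ^ 2 ≤ V y)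
    (q : Fin r → ℝ) (hqm0 : 0 ≤ qm) (hqm : ∀ k, q k ≤ qm) (u : Fin r → EuclideanSpace ℝ (Fin n)) (hu : Orthonormal ℝ u) :
    ∑ k, q k * (∫ y, ⟪u k, y⟫ ∂((volume.restrict K).tilted fun x => -V x)) ^ 2 ≤
      qm * (‖gradient V 0‖ / lam + Real.sqrt (n / lam)) ^ 2 := by
  set ν : Measure (EuclideanSpace ℝ (Fin n)) := (volume.restrict K).tilted fun x => -V x with hν
  have h1 : Integrable (fun y : EuclideanSpace ℝ (Fin n) => y) ν :=
    ((hV1.continuous.neg.rexp.smul continuous_id).continuousOn.integrableOn_compact hKb.isCompact_closure).mono_set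
      subset_closure |> fun h => (integrable_tilted_iff (integrableOn_exp_neg_of_isBounded hKb hV1.continuous) _).2 h
  set m : EuclideanSpace ℝ (Fin n) := ∫ y, y ∂ν with hm
  have hmk : ∀ k, ∫ y, ⟪u k, y⟫ ∂ν = ⟪u k, m⟫ := fun k => integral_inner h1 (u k)
  simp_rw [hmk]
  have hB : ∑ k, ⟪u k, m⟫ ^ 2 ≤ ‖m‖ ^ 2 := by
    have := hu.sum_inner_products_le (s := Finset.univ) (x := m)
    simpa only [Real.norm_eq_abs, sq_abs] using this
  have hmle : ‖m‖ ≤ ‖gradient V 0‖ / lam + Real.sqrt (n / lam) :=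
    norm_windowTiltedMean_le_of_gradient hlam hK hKm hKb hK0 h0 hV1 hV
  have hm2 : ‖m‖ ^ 2 ≤ (‖gradient V 0‖ / lam + Real.sqrt (n / lam)) ^ 2 := pow_le_pow_left₀ (norm_nonneg _) hmle 2
  calc ∑ k, q k * ⟪u k, m⟫ ^ 2 ≤ ∑ k, qm * ⟪u k, m⟫ ^ 2 :=
        Finset.sum_le_sum fun k _ => mul_le_mul_of_nonneg_right (hqm k) (sq_nonneg _)
    _ = qm * ∑ k, ⟪u k, m⟫ ^ 2 := by rw [Finset.mul_sum]
    _ ≤ qm * ‖m‖ ^ 2 := mul_le_mul_of_nonneg_left hB hqm0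
    _ ≤ qm * (‖gradient V 0‖ / lam + Real.sqrt (n / lam)) ^ 2 := mul_le_mul_of_nonneg_left hm2 hqm0

/-! ## §3 The END with the centre's gradient displayed -/

/-- **THE WINDOWED CONVEXITY ROAD WITHOUT A CENTRE LETTER.**  `K` convex, bounded, measurable with `0 ∈ K`; `V ∈ C¹`, `λ`-uniformly
convex ON `K` in the first-order sense; `u` ORTHONORMAL, `0 ≤ q_k ≤ q_max`.  Then
`∫_K e^{−V} ≤ exp((Σ_k q_k)∕λ + q_max·(‖∇V 0‖∕λ + √(n∕λ))²) · ∫_K e^{−(V + Σ_k q_k⟪u_k,·⟫²)}` — the nominal centre's gradient `∇V 0` is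
DISPLAYED, not asked to vanish (refuter κ-ne7bref-g72-1 (ii) ∕ N-ne7bref-g73-1). [folklore] -/
theorem exp_moment_le_of_uniformlyConvex_on_boundedConvexWindow_orthonormal_of_gradient {V : EuclideanSpace ℝ (Fin n) → ℝ}
    {lam qm : ℝ} {r : ℕ} {K : Set (EuclideanSpace ℝ (Fin n))} (hlam : 0 < lam) (hK : Convex ℝ K) (hKm : MeasurableSet K)
    (hKb : Bornology.IsBounded K) (h0 : (0 : EuclideanSpace ℝ (Fin n)) ∈ K) (hV1 : ContDiff ℝ 1 V)
    (hV : ∀ x ∈ K, ∀ y ∈ K, V x + ⟪gradient V x, y - x⟫ + lam / 2 * ‖y - x‖ ^ 2 ≤ V y)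
    (q : Fin r → ℝ) (hq : ∀ k, 0 ≤ q k) (hqm0 : 0 ≤ qm) (hqm : ∀ k, q k ≤ qm)
    (u : Fin r → EuclideanSpace ℝ (Fin n)) (hu : Orthonormal ℝ u) :
    ∫ x in K, exp (-V x) ≤
      exp ((∑ k, q k) / lam + qm * (‖gradient V 0‖ / lam + Real.sqrt (n / lam)) ^ 2) *
        ∫ x in K, exp (-(V x + ∑ k, q k * ⟪u k, x⟫ ^ 2)) := by
  by_cases hK0 : volume K = 0
  · have h0m : (volume.restrict K : Measure (EuclideanSpace ℝ (Fin n))) = 0 := Measure.restrict_eq_zero.2 hK0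
    rw [h0m, integral_zero_measure, integral_zero_measure, mul_zero]
  refine (exp_moment_le_of_uniformlyConvex_on_boundedConvexWindow hlam hK hKm hKb hV1.continuous hV q hq u).trans
    (mul_le_mul_of_nonneg_right (exp_le_exp.2 ?_) (integral_nonneg fun _ => (exp_pos _).le))
  have hsplit : ∑ k, q k * (lam⁻¹ * ‖u k‖ ^ 2 + (∫ x, ⟪u k, x⟫ ∂((volume.restrict K).tilted fun x => -V x)) ^ 2) =
      (∑ k, q k) / lam + ∑ k, q k * (∫ x, ⟪u k, x⟫ ∂((volume.restrict K).tilted fun x => -V x)) ^ 2 := by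
    rw [div_eq_inv_mul, Finset.mul_sum, ← Finset.sum_add_distrib]
    refine Finset.sum_congr rfl fun k _ => ?_
    rw [hu.1 k]
    ring
  rw [hsplit]
  have hm := sum_mul_sq_windowTiltedMean_le_of_orthonormal_sharp hlam hK hKm hKb hK0 h0 hV1 hV q hqm0 hqm u hu
  linarith

/-! ## §4 The primitive-constants twin and its junction: numbers `σ, h, q_max, B, G₀`, NO centre letter -/

/-- **THE WINDOWED CONVEXITY ROAD FROM PRIMITIVE CONSTANTS WITHOUT A CENTRE LETTER.**  `K` convex, bounded, measurable with `0 ∈ K`;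
`A` symmetric with `⟪v, Av⟫ ≥ σ‖v‖²`; `P ∈ C²` with `D²P(x)[v, v] ≥ −h‖v‖²` for `x ∈ K` and `‖∇P 0‖ ≤ G₀`; `h < 2σ`; `u` orthonormal,
`0 ≤ q_k ≤ q_max`.  Then, for `V = ⟪·, A·⟫ + P` (so `∇V 0 = ∇P 0`), with `λ = 2σ − h`:
`∫_K e^{−V} ≤ exp((Σ_k q_k)∕λ + q_max·(G₀∕λ + √(n∕λ))²) · ∫_K e^{−(V + Σ_k q_k⟪u_k,·⟫²)}`. [folklore] -/
theorem exp_moment_le_of_quadratic_add_hessianSmall_on_convexWindow_orthonormal_of_gradient {P : EuclideanSpace ℝ (Fin n) → ℝ}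
    {σ h qm G₀ : ℝ} {r : ℕ} {K : Set (EuclideanSpace ℝ (Fin n))} (A : EuclideanSpace ℝ (Fin n) →L[ℝ] EuclideanSpace ℝ (Fin n))
    (hK : Convex ℝ K) (hKm : MeasurableSet K) (hKb : Bornology.IsBounded K) (h0 : (0 : EuclideanSpace ℝ (Fin n)) ∈ K)
    (hA : ∀ v w : EuclideanSpace ℝ (Fin n), ⟪A v, w⟫ = ⟪v, A w⟫) (hσ : ∀ v : EuclideanSpace ℝ (Fin n), σ * ‖v‖ ^ 2 ≤ ⟪v, A v⟫)
    (hP : ContDiff ℝ 2 P) (hG : ‖gradient P 0‖ ≤ G₀)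
    (hH : ∀ x ∈ K, ∀ v : EuclideanSpace ℝ (Fin n), -h * ‖v‖ ^ 2 ≤ iteratedFDeriv ℝ 2 P x ![v, v]) (hgap : h < 2 * σ)
    (q : Fin r → ℝ) (hq : ∀ k, 0 ≤ q k) (hqm0 : 0 ≤ qm) (hqm : ∀ k, q k ≤ qm)
    (u : Fin r → EuclideanSpace ℝ (Fin n)) (hu : Orthonormal ℝ u) :
    ∫ x in K, exp (-(⟪x, A x⟫ + P x)) ≤
      exp ((∑ k, q k) / (2 * σ - h) + qm * (G₀ / (2 * σ - h) + Real.sqrt (n / (2 * σ - h))) ^ 2) *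
        ∫ x in K, exp (-((⟪x, A x⟫ + P x) + ∑ k, q k * ⟪u k, x⟫ ^ 2)) := by
  have hlam : 0 < 2 * σ - h := sub_pos.2 hgap
  have hV1 : ContDiff ℝ 1 fun x : EuclideanSpace ℝ (Fin n) => ⟪x, A x⟫ + P x :=
    (contDiff_id.inner ℝ A.contDiff).add (hP.of_le (by norm_num))
  have hgrad : gradient (fun z : EuclideanSpace ℝ (Fin n) => ⟪z, A z⟫ + P z) 0 = gradient P 0 := by
    refine ext_inner_right ℝ fun y => ?_
    rw [inner_gradient_quadratic_add_zero A hA (hP.differentiable (by norm_num) 0) y, inner_gradient_eq_fderiv]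
  refine (exp_moment_le_of_uniformlyConvex_on_boundedConvexWindow_orthonormal_of_gradient (V := fun x => ⟪x, A x⟫ + P x) hlam hK
    hKm hKb h0 hV1 (firstOrderOn_quadratic_add_of_hessianOn A hK hA hσ hP hH) q hq hqm0 hqm u hu).trans
    (mul_le_mul_of_nonneg_right (exp_le_exp.2 ?_) (integral_nonneg fun _ => (exp_pos _).le))
  rw [hgrad]
  have hs0 : 0 ≤ ‖gradient P 0‖ / (2 * σ - h) + Real.sqrt (n / (2 * σ - h)) :=
    add_nonneg (div_nonneg (norm_nonneg _) hlam.le) (Real.sqrt_nonneg _)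
  have hs : ‖gradient P 0‖ / (2 * σ - h) + Real.sqrt (n / (2 * σ - h)) ≤ G₀ / (2 * σ - h) + Real.sqrt (n / (2 * σ - h)) :=
    add_le_add (div_le_div_of_nonneg_right hG hlam.le) le_rfl
  have := mul_le_mul_of_nonneg_left (pow_le_pow_left₀ hs0 hs 2) hqm0
  linarith

/-- The gradient-displayed carrier `∫_K e^{−V} ∕ ∫_K e^{−(V+g)}`, `V = ⟪x,Ax⟫ + P`, is at most
`exp(B∕λ + q_max·(G₀∕λ + √(n∕λ))²)`, `λ = 2σ − h`, once `Σ_k q_k ≤ B`. [folklore] -/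
theorem recentredWindowCarrier_le {P : EuclideanSpace ℝ (Fin n) → ℝ} {σ h qm G₀ B : ℝ} {r : ℕ}
    {K : Set (EuclideanSpace ℝ (Fin n))} (A : EuclideanSpace ℝ (Fin n) →L[ℝ] EuclideanSpace ℝ (Fin n))
    (hK : Convex ℝ K) (hKm : MeasurableSet K) (hKb : Bornology.IsBounded K) (h0 : (0 : EuclideanSpace ℝ (Fin n)) ∈ K)
    (hA : ∀ v w : EuclideanSpace ℝ (Fin n), ⟪A v, w⟫ = ⟪v, A w⟫) (hσ : ∀ v : EuclideanSpace ℝ (Fin n), σ * ‖v‖ ^ 2 ≤ ⟪v, A v⟫)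
    (hP : ContDiff ℝ 2 P) (hG : ‖gradient P 0‖ ≤ G₀)
    (hH : ∀ x ∈ K, ∀ v : EuclideanSpace ℝ (Fin n), -h * ‖v‖ ^ 2 ≤ iteratedFDeriv ℝ 2 P x ![v, v]) (hgap : h < 2 * σ)
    (q : Fin r → ℝ) (hq : ∀ k, 0 ≤ q k) (hqm0 : 0 ≤ qm) (hqm : ∀ k, q k ≤ qm)
    (u : Fin r → EuclideanSpace ℝ (Fin n)) (hu : Orthonormal ℝ u) (hB : ∑ k, q k ≤ B) :
    (∫ x in K, exp (-(⟪x, A x⟫ + P x))) / (∫ x in K, exp (-((⟪x, A x⟫ + P x) + ∑ k, q k * ⟪u k, x⟫ ^ 2))) ≤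
      exp (B / (2 * σ - h) + qm * (G₀ / (2 * σ - h) + Real.sqrt (n / (2 * σ - h))) ^ 2) := by
  refine div_le_of_le_mul₀ (integral_nonneg fun _ => (exp_pos _).le) (exp_pos _).le ?_
  refine (exp_moment_le_of_quadratic_add_hessianSmall_on_convexWindow_orthonormal_of_gradient A hK hKm hKb h0 hA hσ hP hG hH hgap
    q hq hqm0 hqm u hu).trans (mul_le_mul_of_nonneg_right (exp_le_exp.2 ?_) (integral_nonneg fun _ => (exp_pos _).le))
  have := div_le_div_of_nonneg_right hB (sub_pos.2 hgap).le
  linarith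

section Junction

variable {Pt : Type} [DecidableEq Pt] {C : ℕ → Type} {𝒢 : (j : ℕ) → GoodClass (C j)}

/-- **LCS FOR THE GRADIENT-DISPLAYED WINDOWED CARRIER FROM PRIMITIVE CONSTANTS, ON THE SUPPORT — the family-(2) socket WITHOUT a
centre letter.**  At every pattern prefix `g` of a level `j < K` and background `y` let `M j g y = ∫_{Kw} e^{−V} ∕ ∫_{Kw} e^{−(V+g)}`,
`V = ⟪x, A x⟫ + P`, for the data at `(j, g, y)` on `EuclideanSpace ℝ (Fin (n j g))` — window `Kw j g y`, operator `A j g y`, remainder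
`P j g y`, weights `q`, ORTHONORMAL directions `u` —; suppose `M j g` is a.e.-strongly measurable and ON THE SUPPORT OF THE TERM: `Kw`
convex bounded measurable with `0 ∈ Kw`, `A` symmetric `σ j g`-coercive, `P ∈ C²` with `D²P ≥ −(h j g)` ON `Kw` and `‖∇P 0‖ ≤ G₀ j g`,
`h < 2σ`, `0 ≤ q_k ≤ qmax j g`, `Σ_k q_k ≤ B j g` — the numbers `σ, h, qmax, B, G₀` y-UNIFORM, the fibre dimension `n j g`.  Then
`LocCondStability T S K μ ρ₀ M b`, `b j g = B∕(2σ−h) + qmax·(G₀∕(2σ−h) + √(n∕(2σ−h)))²`, integrability conjunct included. [folklore] -/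
theorem locCondStability_of_recentredWindowCarrier_on_support (T : Tower Pt C 𝒢)
    (Spat : (j : ℕ) → (Fin j → Pt) → Finset Pt) (K : ℕ) [∀ j, MeasurableSpace (C j)] (μ : (j : ℕ) → Measure (C j))
    (ρ₀ : C 0 → ℝ) (M : (j : ℕ) → (Fin j → Pt) → C j → ℝ) (n r : (j : ℕ) → (Fin j → Pt) → ℕ)
    (Kw : (j : ℕ) → (g : Fin j → Pt) → C j → Set (EuclideanSpace ℝ (Fin (n j g))))
    (A : (j : ℕ) → (g : Fin j → Pt) → C j → (EuclideanSpace ℝ (Fin (n j g)) →L[ℝ] EuclideanSpace ℝ (Fin (n j g))))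
    (P : (j : ℕ) → (g : Fin j → Pt) → C j → EuclideanSpace ℝ (Fin (n j g)) → ℝ)
    (q : (j : ℕ) → (g : Fin j → Pt) → C j → Fin (r j g) → ℝ)
    (u : (j : ℕ) → (g : Fin j → Pt) → C j → Fin (r j g) → EuclideanSpace ℝ (Fin (n j g)))
    (σ h qmax B G₀ : (j : ℕ) → (Fin j → Pt) → ℝ) (hρ : (𝒢 0).Gd ρ₀) (h0 : ∀ x, 0 ≤ ρ₀ x)
    (hM : ∀ j g, j < K → g ∈ admS T Spat j → ∀ y, M j g y =
      (∫ x in Kw j g y, exp (-(⟪x, A j g y x⟫ + P j g y x))) /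
        ∫ x in Kw j g y, exp (-((⟪x, A j g y x⟫ + P j g y x) + ∑ k, q j g y k * ⟪u j g y k, x⟫ ^ 2)))
    (hMm : ∀ j g, j < K → g ∈ admS T Spat j → AEStronglyMeasurable (M j g) (μ j))
    (hKc : ∀ j g, j < K → g ∈ admS T Spat j → ∀ y, T.eterm ρ₀ j g y ≠ 0 → Convex ℝ (Kw j g y))
    (hKm : ∀ j g, j < K → g ∈ admS T Spat j → ∀ y, T.eterm ρ₀ j g y ≠ 0 → MeasurableSet (Kw j g y))
    (hKb : ∀ j g, j < K → g ∈ admS T Spat j → ∀ y, T.eterm ρ₀ j g y ≠ 0 → Bornology.IsBounded (Kw j g y))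
    (hK0 : ∀ j g, j < K → g ∈ admS T Spat j → ∀ y, T.eterm ρ₀ j g y ≠ 0 → (0 : EuclideanSpace ℝ (Fin (n j g))) ∈ Kw j g y)
    (hA : ∀ j g, j < K → g ∈ admS T Spat j → ∀ y, T.eterm ρ₀ j g y ≠ 0 →
      ∀ v w : EuclideanSpace ℝ (Fin (n j g)), ⟪A j g y v, w⟫ = ⟪v, A j g y w⟫)
    (hσ : ∀ j g, j < K → g ∈ admS T Spat j → ∀ y, T.eterm ρ₀ j g y ≠ 0 →
      ∀ v : EuclideanSpace ℝ (Fin (n j g)), σ j g * ‖v‖ ^ 2 ≤ ⟪v, A j g y v⟫)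
    (hP : ∀ j g, j < K → g ∈ admS T Spat j → ∀ y, T.eterm ρ₀ j g y ≠ 0 → ContDiff ℝ 2 (P j g y))
    (hG : ∀ j g, j < K → g ∈ admS T Spat j → ∀ y, T.eterm ρ₀ j g y ≠ 0 → ‖gradient (P j g y) 0‖ ≤ G₀ j g)
    (hH : ∀ j g, j < K → g ∈ admS T Spat j → ∀ y, T.eterm ρ₀ j g y ≠ 0 →
      ∀ x ∈ Kw j g y, ∀ v : EuclideanSpace ℝ (Fin (n j g)), -h j g * ‖v‖ ^ 2 ≤ iteratedFDeriv ℝ 2 (P j g y) x ![v, v])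
    (hgap : ∀ j g, j < K → g ∈ admS T Spat j → h j g < 2 * σ j g)
    (hq : ∀ j g, j < K → g ∈ admS T Spat j → ∀ y k, 0 ≤ q j g y k)
    (hqm0 : ∀ j g, j < K → g ∈ admS T Spat j → 0 ≤ qmax j g)
    (hqm : ∀ j g, j < K → g ∈ admS T Spat j → ∀ y, T.eterm ρ₀ j g y ≠ 0 → ∀ k, q j g y k ≤ qmax j g)
    (hu : ∀ j g, j < K → g ∈ admS T Spat j → ∀ y, T.eterm ρ₀ j g y ≠ 0 → Orthonormal ℝ (u j g y))
    (hB : ∀ j g, j < K → g ∈ admS T Spat j → ∀ y, T.eterm ρ₀ j g y ≠ 0 → ∑ k, q j g y k ≤ B j g)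
    (hint : ∀ j g, j < K → g ∈ admS T Spat j → Integrable (T.eterm ρ₀ j g) (μ j)) :
    LocCondStability T Spat K μ ρ₀ M (fun j g => B j g / (2 * σ j g - h j g) +
      qmax j g * (G₀ j g / (2 * σ j g - h j g) + Real.sqrt (n j g / (2 * σ j g - h j g))) ^ 2) := by
  refine locCondStability_of_carrier_le_on_support T Spat K μ ρ₀ M _ hρ h0 hMm (fun j g hj hg y => ?_)
    (fun j g hj hg y hy => ?_) hint
  · rw [hM j g hj hg y]
    exact div_nonneg (integral_nonneg fun _ => (exp_pos _).le) (integral_nonneg fun _ => (exp_pos _).le)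
  · rw [hM j g hj hg y]
    exact recentredWindowCarrier_le (A j g y) (hKc j g hj hg y hy) (hKm j g hj hg y hy) (hKb j g hj hg y hy) (hK0 j g hj hg y hy)
      (hA j g hj hg y hy) (hσ j g hj hg y hy) (hP j g hj hg y hy) (hG j g hj hg y hy) (hH j g hj hg y hy) (hgap j g hj hg)
      _ (hq j g hj hg y) (hqm0 j g hj hg) (hqm j g hj hg y hy) _ (hu j g hj hg y hy) (hB j g hj hg y hy)

end Junction

end Summit.QuantumFields.BalabanUV.T4Continuum.NE7b.ConvexWindowTiltRecentred

end
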